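/-
Copyright: statement-level skeleton of a published paper (lit-balaban cell, Phase-2 proof seat p39 gen 9). No proof claims
beyond what the kernel checks below.
-/
import Literature.MathematicalPhysics.QuantumFieldTheory.Balaban1983to89.B3Pi2ZeroLattice
import Literature.MathematicalPhysics.QuantumFieldTheory.Balaban1983to89.B3Eq327Cxi

/-!
# B3 — T. Bałaban, *(Higgs)₂,₃ quantum fields in a finite volume. III. Renormalization*, CMP **88** (1983) 411–445
[Balaban1983Higgs3], (3.27) p. 441 / p. 442 [PDF 31–32]: **the kernel Π_{μμ′ν} of the first curly bracket of (3.26) with the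
infinite-lattice propagator `G^ξ_{j₀}(0)` in both slots is bounded uniformly in the lattice spacing** — ON THE PRINTED INFINITE
LATTICE ξℤ³, where the pure-`C^ξ` part is (3.27) and VANISHES EXACTLY (r15's `lhs327_Cxi_eq_zero`)

statement-level skeleton of published theorems with citation tags; proofs where landed; nothing here is a claim about
the Yang–Mills mass gap

PDF held: `paper:balaban1983-higgs-2-3-quantum-fields-finite-volume` (journal page = PDF page + 410); pp. 441–442 [PDF 31–32] read
on the ×2 renders `run/shared/lean/pub/pub-balaban/b2b-balaban-ref1/pages/1983-cmp88-higgs23-III/1983-cmp88-higgs23-III-p031-x2.png`,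
`-p032-x2.png`.  p. 441: *"the expression in the first curly bracket has the form Σ_ν Σ_x η^d Σ_{μ,μ′} g(x)A_μ(x)
Π^{(η,j₀)}_{μμ′ν}(x)(∂^η_νg′A′_{μ′})(x) … If at least one propagator G_{j₀}(0) is replaced by G_{j₀}(0)(1 − m² − aP)C^ξ, then we get
a convergent expression … [with C^ξ:] tr q² Σ_{y′}ξ^d[−(C^ξ∂^{ξ*}_{μ′})(y−y′)(C^ξ∂^{ξ*}_μ)(y′−y)(y′_ν−y_ν) + C^ξ(y−y′)
(∂^ξ_{μ′}C^ξ∂^{ξ*}_μ)(y′−y)(y′_ν−y_ν)] = … (3.27)"*, p. 442: *"Thus the expression (3.27) is equal to 0 and the coefficient at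
the vertex [Π_{μμ′ν}] is bounded"*.  Rows **B3.Eq3.25-3.32** of `HOME/lit-balaban-r15/ROWS-B3.md` (fold owner r15); file 6 of the
p39 gen-9 programme «the §3 vector self-energy sentences on the PRINTED infinite lattice ξℤ³» (gen 8 proved the torus reading
`B3Pi3TorusBounded`; on ξℤ³ the pure-C^ξ part is r15's `lhs327`, which is zero as printed).
WHAT IS REPRODUCED (`d = 3`, `ξ = L^{−k}`, volume element `Σ ξ³`, `τ = tr q²`, `G = G^ξ_k(0)` = `GxiL`, `M = G − C^ξ`; the
displacement `y′_ν − y_ν` in lattice units is `ξ(y′_ν − y_ν)`, exactly as in r15's `lhs327`):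
* §1 `nonloc3`, **`Pi3L`** — `Π_{μμ′ν}[K₁,K₂](y) = τΣ'_{y′}ξ³[−(K₁∂^*_{μ′})(y,y′)(K₂∂^*_μ)(y′,y) + K₁(y,y′)(∂_{μ′}K₂∂^*_μ)(y′,y)]·
  ξ(y′_ν − y_ν)` for two-variable kernels; `Pi3L_conv`: on convolution kernels it IS r15's `lhs327`, hence `Pi3L_Cxi_eq_zero`
  (**(3.27) = 0 on ξℤ³**, r15's `lhs327_Cxi_eq_zero` with p03's (3.28)).
* §2 the weight costs one power: `|ξ(y′−y)_ν|·P_{q+1}^δ(y′−y) ≤ P_q^δ(y′−y)` (`abs_weight_mul_prof_le`).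
* §3 **`tsum_nonloc3_M_G_bound`** — the `[M,G]` term: the first piece is the Fubini form of `B3Eq316DifferenceKernelBounds` with
  the weighted leg `κ = (G∂^*_μ)(·,y)·ξ(·−y)_ν`, `|κ| ≤ C·P₁^δ ≤ C(1+2/δ)P₂^{δ/2}` (rate `δ/2`); the second is bounded termwise
  (`|M| ≤ K`, `|∂G∂^*|·|weight| ≤ C·P₂^δ`).
* §4 **`tsum_nonloc3_conv_M_bound`** — the `[C^ξ,M]` term: the first piece is the TRANSPOSED Fubini form (`M` symmetric:
  `(M∂^*_μ)(y′,y) = (∂_μM)(y,y′)`) with `κ = (C^ξ∂^*_{μ′})(y−y′)·ξ(y′−y)_ν`, `|κ| ≤ C·P₁^δ`; the second is bounded termwise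
  (`|C^ξ| ≤ CP₁`, `|∂M∂^*|·|weight| ≤ K`).
* §5 **`exists_Pi3L_GxiL_bound`** — THE PRINTED CLAIM *"the coefficient at the vertex [Π_{μμ′ν}] is bounded"* for the
  infinite-lattice propagator: `|Π_{μμ′ν}[G^ξ_k(0),G^ξ_k(0)](y)| ≤ Cst·|tr q²|` for every `k ≥ 1`, window, `μ, μ′, ν, y`, with
  `Cst` a function of `L` and the window — via `Π[G,G] = Π[C,C] + τΣ nonloc3[C,M] + τΣ nonloc3[M,G]` and `Π[C,C] = (3.27) = 0`.
HONEST SCOPE: zero external field, `d = 3`, unit blocks, one scale in both slots, the legs `g, A, ∂_ν(g′A′)` of (3.26) left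
outside; the printed middle/last members of (3.27) and the `(L^{j₀}η)^{−d+2}` scaling remark for `Π_{μμ′}` are r15's/p03's rows
and are not restated.  Mathlib + the cited tree files only; definitions with bodies and theorems, no named facts; standard
axioms.  Unit `lit-balaban-p39-g9` (Phase-2 proof seat p39, gen 9), HOME `run/shared/lean/pub/lit-balaban/`, 2026-08-22.
-/

open scoped BigOperators
open Finset Filter Topology

namespace Literature.MathematicalPhysics.QuantumFieldTheory.Balaban1983to89.B3Pi3ZeroLattice

open B3Sect3VectorSelfEnergy B3CxiUniformBound B3ZdLatticeProfileSums B3ZdKernelConvolutions B3Eq316ResolventZeroLattice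
  B3Eq316DifferenceKernelBounds B3Pi2ZeroLattice
open B3Eq327Cxi (lhs327_Cxi_eq_zero)
open B3CxiLatticePairSums (supNorm_unitVec)

noncomputable section

/-! ## §1 Π_{μμ′ν} on ξℤ³ for two-variable kernels -/

/-- the non-local integrand of the first curly bracket of (3.26) with the displacement weight `ξ(y′_ν − y_ν)` (the shape of
r15's `lhs327`). [cite: Balaban1983Higgs3, (3.27) p.441] -/
def nonloc3 (ξ : ℝ) (K₁ K₂ : ZSite 3 → ZSite 3 → ℝ) (μ μ' ν : Fin 3) (y y' : ZSite 3) : ℝ :=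
  ξ ^ 3 * (-(dK2 ξ μ' K₁ y y' * dK2 ξ μ K₂ y' y * (ξ * ((y' ν : ℝ) - y ν))) +
    K₁ y y' * d2K ξ μ' μ K₂ y' y * (ξ * ((y' ν : ℝ) - y ν)))

/-- **Π_{μμ′ν}[K₁,K₂](y)** — the kernel Π^{(η,j₀)}_{μμ′ν} of p. 441 (r15's torus `Pi3`) ON THE INFINITE LATTICE ξℤ³ for two
two-variable kernels: `τΣ'_{y′} nonloc3[K₁,K₂](y,y′)`, `τ = tr q²`. [cite: Balaban1983Higgs3, (3.27) p.441] -/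
def Pi3L (ξ τ : ℝ) (K₁ K₂ : ZSite 3 → ZSite 3 → ℝ) (μ μ' ν : Fin 3) (y : ZSite 3) : ℝ :=
  τ * ∑' y', nonloc3 ξ K₁ K₂ μ μ' ν y y'

section Algebra

variable {ξ : ℝ}

/-- **On the convolution kernel `C^ξ`, `Π_{μμ′ν}` is r15's `lhs327`** (the left side of (3.27)).
[cite: Balaban1983Higgs3, (3.27) p.441] -/
theorem Pi3L_conv (ξ τ : ℝ) (μ μ' ν : Fin 3) (y : ZSite 3) :
    Pi3L ξ τ (fun a b => Cxi 3 ξ (a - b)) (fun a b => Cxi 3 ξ (a - b)) μ μ' ν y = lhs327 3 ξ τ y μ μ' ν := by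
  simp only [Pi3L, lhs327, nonloc3, dK2_conv, d2K_conv]

/-- **(3.27) = 0 ON ξℤ³**: the pure-`C^ξ` kernel `Π_{μμ′ν}[C^ξ,C^ξ]` vanishes (r15's `lhs327_Cxi_eq_zero`, with p03's (3.28);
p. 442 *"Thus the expression (3.27) is equal to 0"*). [cite: Balaban1983Higgs3, (3.27) p.442] -/
theorem Pi3L_Cxi_eq_zero (hξ : 0 < ξ) (τ : ℝ) (μ μ' ν : Fin 3) (y : ZSite 3) :
    Pi3L ξ τ (fun a b => Cxi 3 ξ (a - b)) (fun a b => Cxi 3 ξ (a - b)) μ μ' ν y = 0 := by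
  rw [Pi3L_conv]; exact lhs327_Cxi_eq_zero hξ τ y μ μ' ν

/-- additivity in the first slot. [cite: Balaban1983Higgs3, (3.27) p.441] -/
theorem nonloc3_add_left (ξ : ℝ) (K₁ K₁' K₂ : ZSite 3 → ZSite 3 → ℝ) (μ μ' ν : Fin 3) (y y' : ZSite 3) :
    nonloc3 ξ (K₁ + K₁') K₂ μ μ' ν y y' = nonloc3 ξ K₁ K₂ μ μ' ν y y' + nonloc3 ξ K₁' K₂ μ μ' ν y y' := by
  simp only [nonloc3, dK2_add, Pi.add_apply]; ring

/-- additivity in the second slot. [cite: Balaban1983Higgs3, (3.27) p.441] -/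
theorem nonloc3_add_right (ξ : ℝ) (K₁ K₂ K₂' : ZSite 3 → ZSite 3 → ℝ) (μ μ' ν : Fin 3) (y y' : ZSite 3) :
    nonloc3 ξ K₁ (K₂ + K₂') μ μ' ν y y' = nonloc3 ξ K₁ K₂ μ μ' ν y y' + nonloc3 ξ K₁ K₂' μ μ' ν y y' := by
  simp only [nonloc3, dK2_add, d2K_add]; ring

end Algebra

/-! ## §2 The displacement weight costs one power of the distance -/

section Weight

variable {ξ δ : ℝ}

/-- kernel: `|y′_ν − y_ν| ≤ max(1, |y′ − y|_∞)`. [cite: Balaban1983Higgs3, (3.27) p.441] -/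
theorem abs_coord_sub_le (ν : Fin 3) (y y' : ZSite 3) : |((y' ν : ℝ) - y ν)| ≤ max 1 (supNorm (y' - y) : ℝ) := by
  have h := le_supNorm (y' - y) ν
  have h' : (((y' - y) ν).natAbs : ℝ) ≤ (supNorm (y' - y) : ℝ) := by exact_mod_cast h
  rw [Nat.cast_natAbs, Int.cast_abs, Pi.sub_apply, Int.cast_sub] at h'
  exact h'.trans (le_max_right _ _)

/-- **The weight costs one power**: `|ξ(y′_ν − y_ν)|·P_{q+1}^δ(y′ − y) ≤ P_q^δ(y′ − y)`. [cite: Balaban1983Higgs3, (3.27) p.441] -/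
theorem abs_weight_mul_prof_le (hξ : 0 < ξ) (δ : ℝ) (q : ℕ) (ν : Fin 3) (y y' : ZSite 3) :
    |ξ * ((y' ν : ℝ) - y ν)| * prof ξ δ (q + 1) (y' - y) ≤ prof ξ δ q (y' - y) := by
  have hm : (1 : ℝ) ≤ max 1 (supNorm (y' - y) : ℝ) := le_max_left _ _
  have hx : 0 < ξ * max 1 (supNorm (y' - y) : ℝ) := by positivity
  have hw : |ξ * ((y' ν : ℝ) - y ν)| ≤ ξ * max 1 (supNorm (y' - y) : ℝ) := by
    rw [abs_mul, abs_of_pos hξ]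
    exact mul_le_mul_of_nonneg_left (abs_coord_sub_le ν y y') hξ.le
  unfold prof
  calc |ξ * ((y' ν : ℝ) - y ν)| * (((ξ * max 1 (supNorm (y' - y) : ℝ)) ^ (q + 1))⁻¹ *
        Real.exp (-(δ * (ξ * (supNorm (y' - y) : ℝ)))))
      ≤ (ξ * max 1 (supNorm (y' - y) : ℝ)) * (((ξ * max 1 (supNorm (y' - y) : ℝ)) ^ (q + 1))⁻¹ *
        Real.exp (-(δ * (ξ * (supNorm (y' - y) : ℝ))))) := mul_le_mul_of_nonneg_right hw (by positivity)
    _ = ((ξ * max 1 (supNorm (y' - y) : ℝ)) ^ q)⁻¹ * Real.exp (-(δ * (ξ * (supNorm (y' - y) : ℝ)))) := by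
        rw [pow_succ]; field_simp

/-- kernel: `P_0^δ ≤ 1`. [cite: Balaban1983Higgs3, (3.27) p.441] -/
theorem prof_zero_le_one (hξ : 0 ≤ ξ) (hδ : 0 ≤ δ) (u : ZSite 3) : prof ξ δ 0 u ≤ 1 := by
  unfold prof
  rw [pow_zero, inv_one, one_mul]
  have h0 : 0 ≤ δ * (ξ * (supNorm u : ℝ)) := by positivity
  exact Real.exp_le_one_iff.2 (by linarith)

end Weight

/-! ## §3 The `[M, G]` term -/

section CrossMG

variable {ℓ k : ℕ} {a m2 : ℝ}

/-- **THE `[M, G]` TERM OF Π_{μμ′ν} IS BOUNDED**: with the weighted leg `κ(y′) = (G∂^*_μ)(y′,y)·ξ(y′−y)_ν`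
(`|κ| ≤ C·P₁^δ ≤ C(1+2/δ)·P₂^{δ/2}`) the first piece is the Fubini form of `B3Eq316DifferenceKernelBounds` at rate `δ/2`; the
second is `Σ ξ³|M|·|∂G∂^*|·|weight| ≤ K·C·Σξ³P₂^δ`. [cite: Balaban1983Higgs3, (3.27) p.441] -/
theorem tsum_nonloc3_M_G_bound {δ C K : ℝ} (hδ : 0 < δ) (hδ1 : δ ≤ 1) (hC : 0 ≤ C) (hK : 0 ≤ K)
    (l3 : ∀ (μ : Fin 3) (y z : ZSite 3), |dK2 (xiOf ℓ k) μ (GxiL ℓ k a m2) y z| ≤ C * prof (xiOf ℓ k) δ 2 (y - z))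
    (l4 : ∀ (μ' μ : Fin 3) (x y : ZSite 3), |d2K (xiOf ℓ k) μ' μ (GxiL ℓ k a m2) x y| ≤ C * prof (xiOf ℓ k) δ 3 (x - y))
    (bM : ∀ y y' : ZSite 3, |MxiL ℓ k a m2 y y'| ≤ K)
    (fubw : ∀ (δ' : ℝ), 0 < δ' → δ' ≤ δ → ∀ (μ' : Fin 3) (y : ZSite 3) (κ : ZSite 3 → ℝ) (b : ℝ), 0 ≤ b →
      (∀ x', |κ x'| ≤ b * prof (xiOf ℓ k) δ' 2 (x' - y)) →
      Summable (fun x' => (xiOf ℓ k) ^ 3 * (dK2 (xiOf ℓ k) μ' (MxiL ℓ k a m2) y x' * κ x')) ∧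
        |∑' x', (xiOf ℓ k) ^ 3 * (dK2 (xiOf ℓ k) μ' (MxiL ℓ k a m2) y x' * κ x')| ≤
          C * C * b * (1400 * (833 / (δ' / 2) ^ 3)))
    (μ μ' ν : Fin 3) (y : ZSite 3) :
    Summable (fun y' => nonloc3 (xiOf ℓ k) (MxiL ℓ k a m2) (GxiL ℓ k a m2) μ μ' ν y y') ∧
      |∑' y', nonloc3 (xiOf ℓ k) (MxiL ℓ k a m2) (GxiL ℓ k a m2) μ μ' ν y y'| ≤
        C * C * (C * (1 + 2 / δ)) * (1400 * (833 / (δ / 2 / 2) ^ 3)) + K * C * (833 / δ ^ 3) := by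
  set ξ : ℝ := xiOf ℓ k with hξdef
  have hξ : 0 < ξ := xiOf_pos ℓ k
  have hξ1 : ξ ≤ 1 := xiOf_le_one ℓ k
  have hδh : 0 < δ / 2 := by linarith
  -- the weighted leg
  set κ : ZSite 3 → ℝ := fun y' => dK2 ξ μ (GxiL ℓ k a m2) y' y * (ξ * ((y' ν : ℝ) - y ν)) with hκdef
  have hκ1 : ∀ y', |κ y'| ≤ C * prof ξ δ 1 (y' - y) := by
    intro y'
    simp only [hκdef]
    rw [abs_mul]
    have h1 := l3 μ y' y
    have hw := abs_weight_mul_prof_le hξ δ 1 ν y y'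
    calc |dK2 ξ μ (GxiL ℓ k a m2) y' y| * |ξ * ((y' ν : ℝ) - y ν)|
        ≤ (C * prof ξ δ 2 (y' - y)) * |ξ * ((y' ν : ℝ) - y ν)| := mul_le_mul_of_nonneg_right h1 (abs_nonneg _)
      _ = C * (|ξ * ((y' ν : ℝ) - y ν)| * prof ξ δ (1 + 1) (y' - y)) := by ring
      _ ≤ C * prof ξ δ 1 (y' - y) := mul_le_mul_of_nonneg_left hw hC
  have hκ2 : ∀ y', |κ y'| ≤ C * (1 + 2 / δ) * prof ξ (δ / 2) 2 (y' - y) := by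
    intro y'
    refine (hκ1 y').trans ?_
    rw [mul_assoc]
    exact mul_le_mul_of_nonneg_left (profile_one_le_two_half hξ hξ1 hδ (y' - y)) hC
  obtain ⟨sA, hA⟩ := fubw (δ / 2) hδh (by linarith) μ' y κ (C * (1 + 2 / δ)) (by positivity) hκ2
  -- the second piece, termwise
  set ρ : ZSite 3 → ℝ := fun y' => d2K ξ μ' μ (GxiL ℓ k a m2) y' y * (ξ * ((y' ν : ℝ) - y ν)) with hρdef
  have hρ : ∀ y', |ρ y'| ≤ C * prof ξ δ 2 (y' - y) := by
    intro y'
    simp only [hρdef]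
    rw [abs_mul]
    have h1 := l4 μ' μ y' y
    have hw := abs_weight_mul_prof_le hξ δ 2 ν y y'
    calc |d2K ξ μ' μ (GxiL ℓ k a m2) y' y| * |ξ * ((y' ν : ℝ) - y ν)|
        ≤ (C * prof ξ δ 3 (y' - y)) * |ξ * ((y' ν : ℝ) - y ν)| := mul_le_mul_of_nonneg_right h1 (abs_nonneg _)
      _ = C * (|ξ * ((y' ν : ℝ) - y ν)| * prof ξ δ (2 + 1) (y' - y)) := by ring
      _ ≤ C * prof ξ δ 2 (y' - y) := mul_le_mul_of_nonneg_left hw hC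
  have hMb : ∀ y', |MxiL ℓ k a m2 y y'| ≤ K := fun y' => bM y y'
  have sB : Summable fun y' => MxiL ℓ k a m2 y y' * ρ y' :=
    (summable_abs_bdd_mul_prof hξ hξ1 hδ hδ1 le_rfl y hMb hρ).of_abs
  -- the integrand
  have hint : ∀ y', nonloc3 ξ (MxiL ℓ k a m2) (GxiL ℓ k a m2) μ μ' ν y y' =
      -(ξ ^ 3 * (dK2 ξ μ' (MxiL ℓ k a m2) y y' * κ y')) + ξ ^ 3 * (MxiL ℓ k a m2 y y' * ρ y') := by
    intro y'; simp only [nonloc3, hκdef, hρdef]; ring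
  have hsum : Summable (fun y' => nonloc3 ξ (MxiL ℓ k a m2) (GxiL ℓ k a m2) μ μ' ν y y') := by
    simp_rw [hint]; exact sA.neg.add (sB.mul_left _)
  refine ⟨hsum, ?_⟩
  -- the bound on the second piece
  obtain ⟨-, ⟨hs2, hle2⟩⟩ := tsum_profile_shift_le hξ hξ1 hδ hδ1 (le_refl 2) y y
  have hB : |∑' y', ξ ^ 3 * (MxiL ℓ k a m2 y y' * ρ y')| ≤ K * C * (833 / δ ^ 3) := by
    have hs : Summable fun y' => K * C * (ξ ^ 3 * prof ξ δ 2 (y' - y)) := hs2.mul_left _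
    refine (abs_tsum_le_tsum_of_abs_le (sB.mul_left _) hs fun y' => ?_).trans ?_
    · rw [abs_mul, abs_mul, abs_of_pos (by positivity : (0 : ℝ) < ξ ^ 3)]
      have hp := prof_nonneg hξ.le δ 2 (y' - y)
      calc ξ ^ 3 * (|MxiL ℓ k a m2 y y'| * |ρ y'|) ≤ ξ ^ 3 * (K * (C * prof ξ δ 2 (y' - y))) :=
            mul_le_mul_of_nonneg_left (mul_le_mul (hMb y') (hρ y') (abs_nonneg _) hK) (by positivity)
        _ = _ := by ring
    · rw [tsum_mul_left]
      exact mul_le_mul_of_nonneg_left hle2 (by positivity)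
  simp_rw [hint]
  rw [sA.neg.tsum_add (sB.mul_left _), tsum_neg]
  calc |-(∑' y', ξ ^ 3 * (dK2 ξ μ' (MxiL ℓ k a m2) y y' * κ y')) + ∑' y', ξ ^ 3 * (MxiL ℓ k a m2 y y' * ρ y')|
      ≤ |-(∑' y', ξ ^ 3 * (dK2 ξ μ' (MxiL ℓ k a m2) y y' * κ y'))| + |∑' y', ξ ^ 3 * (MxiL ℓ k a m2 y y' * ρ y')| :=
        abs_add_le _ _
    _ ≤ C * C * (C * (1 + 2 / δ)) * (1400 * (833 / (δ / 2 / 2) ^ 3)) + K * C * (833 / δ ^ 3) := by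
        rw [abs_neg]; exact add_le_add hA hB

end CrossMG

/-! ## §4 The `[C^ξ, M]` term -/

section CrossCM

variable {ℓ k : ℕ} {a m2 : ℝ}

/-- **THE `[C^ξ, M]` TERM OF Π_{μμ′ν} IS BOUNDED**: by the symmetry of `M`, `(M∂^*_μ)(y′,y) = (∂_μM)(y,y′)`, so the first piece
is the transposed Fubini form of `B3Eq316DifferenceKernelBounds` with the weighted leg `κ(y′) = (C^ξ∂^*_{μ′})(y−y′)·ξ(y′−y)_ν`,
`|κ| ≤ C·P₁^δ`; the second is `Σ ξ³|C^ξ(y−y′)|·|∂M∂^*(y′,y)|·|weight| ≤ C·K·Σξ³P₁^δ`. [cite: Balaban1983Higgs3, (3.27) p.441] -/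
theorem tsum_nonloc3_conv_M_bound {δ C K : ℝ} (hδ : 0 < δ) (hδ1 : δ ≤ 1) (hC : 0 ≤ C) (hK : 0 ≤ K)
    (l7 : ∀ u : ZSite 3, |Cxi 3 (xiOf ℓ k) u| ≤ C * prof (xiOf ℓ k) δ 1 u)
    (l8 : ∀ (μ : Fin 3) (u : ZSite 3), |pdiffAdjZ (xiOf ℓ k)⁻¹ μ (Cxi 3 (xiOf ℓ k)) u| ≤ C * prof (xiOf ℓ k) δ 2 u)
    (bd2 : ∀ (μ' μ : Fin 3) (x y : ZSite 3), |d2K (xiOf ℓ k) μ' μ (MxiL ℓ k a m2) x y| ≤ K * prof (xiOf ℓ k) (δ / 2) 1 (x - y))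
    (fubt : ∀ (μ : Fin 3) (y : ZSite 3) (κ : ZSite 3 → ℝ) (b : ℝ), 0 ≤ b →
      (∀ y', |κ y'| ≤ b * prof (xiOf ℓ k) δ 1 (y' - y)) →
      Summable (fun y' => (xiOf ℓ k) ^ 3 * (dK1 (xiOf ℓ k) μ (MxiL ℓ k a m2) y y' * κ y')) ∧
        |∑' y', (xiOf ℓ k) ^ 3 * (dK1 (xiOf ℓ k) μ (MxiL ℓ k a m2) y y' * κ y')| ≤
          C * C * b * ((833 / δ ^ 3) * (833 / δ ^ 3)))
    (μ μ' ν : Fin 3) (y : ZSite 3) :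
    Summable (fun y' => nonloc3 (xiOf ℓ k) (fun x z => Cxi 3 (xiOf ℓ k) (x - z)) (MxiL ℓ k a m2) μ μ' ν y y') ∧
      |∑' y', nonloc3 (xiOf ℓ k) (fun x z => Cxi 3 (xiOf ℓ k) (x - z)) (MxiL ℓ k a m2) μ μ' ν y y'| ≤
        C * C * C * ((833 / δ ^ 3) * (833 / δ ^ 3)) + C * K * (833 / δ ^ 3) := by
  set ξ : ℝ := xiOf ℓ k with hξdef
  have hξ : 0 < ξ := xiOf_pos ℓ k
  have hξ1 : ξ ≤ 1 := xiOf_le_one ℓ k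
  have hδh : 0 < δ / 2 := by linarith
  -- `M` is symmetric: the second-variable difference at `(y′, y)` is the first-variable difference at `(y, y′)`
  have hsym : ∀ y', dK2 ξ μ (MxiL ℓ k a m2) y' y = dK1 ξ μ (MxiL ℓ k a m2) y y' := by
    intro y'; simp only [dK2, dK1, MxiL_comm (y + unitVec μ) y', MxiL_comm y y']
  -- the weighted leg
  set κ : ZSite 3 → ℝ := fun y' => pdiffAdjZ ξ⁻¹ μ' (Cxi 3 ξ) (y - y') * (ξ * ((y' ν : ℝ) - y ν)) with hκdef
  have hκ : ∀ y', |κ y'| ≤ C * prof ξ δ 1 (y' - y) := by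
    intro y'
    simp only [hκdef]
    rw [abs_mul]
    have h1 : |pdiffAdjZ ξ⁻¹ μ' (Cxi 3 ξ) (y - y')| ≤ C * prof ξ δ 2 (y' - y) := (l8 μ' _).trans_eq (by rw [prof_sub_comm])
    have hw := abs_weight_mul_prof_le hξ δ 1 ν y y'
    calc |pdiffAdjZ ξ⁻¹ μ' (Cxi 3 ξ) (y - y')| * |ξ * ((y' ν : ℝ) - y ν)|
        ≤ (C * prof ξ δ 2 (y' - y)) * |ξ * ((y' ν : ℝ) - y ν)| := mul_le_mul_of_nonneg_right h1 (abs_nonneg _)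
      _ = C * (|ξ * ((y' ν : ℝ) - y ν)| * prof ξ δ (1 + 1) (y' - y)) := by ring
      _ ≤ C * prof ξ δ 1 (y' - y) := mul_le_mul_of_nonneg_left hw hC
  obtain ⟨sA, hA⟩ := fubt μ y κ C hC hκ
  -- the second piece: `|∂M∂^*(y′,y)·weight| ≤ K`
  set ρ : ZSite 3 → ℝ := fun y' => d2K ξ μ' μ (MxiL ℓ k a m2) y' y * (ξ * ((y' ν : ℝ) - y ν)) with hρdef
  have hρ : ∀ y', |ρ y'| ≤ K := by
    intro y'
    simp only [hρdef]
    rw [abs_mul]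
    have h1 := bd2 μ' μ y' y
    have hw := abs_weight_mul_prof_le hξ (δ / 2) 0 ν y y'
    have h0 := prof_zero_le_one hξ.le hδh.le (y' - y)
    calc |d2K ξ μ' μ (MxiL ℓ k a m2) y' y| * |ξ * ((y' ν : ℝ) - y ν)|
        ≤ (K * prof ξ (δ / 2) 1 (y' - y)) * |ξ * ((y' ν : ℝ) - y ν)| := mul_le_mul_of_nonneg_right h1 (abs_nonneg _)
      _ = K * (|ξ * ((y' ν : ℝ) - y ν)| * prof ξ (δ / 2) (0 + 1) (y' - y)) := by ring
      _ ≤ K * 1 := mul_le_mul_of_nonneg_left (hw.trans h0) hK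
      _ = K := mul_one K
  have hCf : ∀ y', |Cxi 3 ξ (y - y')| ≤ C * prof ξ δ 1 (y - y') := fun y' => l7 _
  have sB : Summable fun y' => Cxi 3 ξ (y - y') * ρ y' :=
    (summable_abs_prof_mul_bdd hξ hξ1 hδ hδ1 (by norm_num : 1 ≤ 2) y hCf hρ).of_abs
  -- the integrand
  have hint : ∀ y', nonloc3 ξ (fun x z => Cxi 3 ξ (x - z)) (MxiL ℓ k a m2) μ μ' ν y y' =
      -(ξ ^ 3 * (dK1 ξ μ (MxiL ℓ k a m2) y y' * κ y')) + ξ ^ 3 * (Cxi 3 ξ (y - y') * ρ y') := by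
    intro y'; simp only [nonloc3, dK2_conv, hκdef, hρdef, ← hsym]; ring
  have hsum : Summable (fun y' => nonloc3 ξ (fun x z => Cxi 3 ξ (x - z)) (MxiL ℓ k a m2) μ μ' ν y y') := by
    simp_rw [hint]; exact sA.neg.add (sB.mul_left _)
  refine ⟨hsum, ?_⟩
  obtain ⟨⟨hs1, hle1⟩, -⟩ := tsum_profile_shift_le hξ hξ1 hδ hδ1 (by norm_num : 1 ≤ 2) y y
  have hB : |∑' y', ξ ^ 3 * (Cxi 3 ξ (y - y') * ρ y')| ≤ C * K * (833 / δ ^ 3) := by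
    have hs : Summable fun y' => C * K * (ξ ^ 3 * prof ξ δ 1 (y - y')) := hs1.mul_left _
    refine (abs_tsum_le_tsum_of_abs_le (sB.mul_left _) hs fun y' => ?_).trans ?_
    · rw [abs_mul, abs_mul, abs_of_pos (by positivity : (0 : ℝ) < ξ ^ 3)]
      have hp := prof_nonneg hξ.le δ 1 (y - y')
      calc ξ ^ 3 * (|Cxi 3 ξ (y - y')| * |ρ y'|) ≤ ξ ^ 3 * ((C * prof ξ δ 1 (y - y')) * K) :=
            mul_le_mul_of_nonneg_left (mul_le_mul (hCf y') (hρ y') (abs_nonneg _) (by positivity)) (by positivity)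
        _ = _ := by ring
    · rw [tsum_mul_left]
      exact mul_le_mul_of_nonneg_left hle1 (by positivity)
  simp_rw [hint]
  rw [sA.neg.tsum_add (sB.mul_left _), tsum_neg]
  calc |-(∑' y', ξ ^ 3 * (dK1 ξ μ (MxiL ℓ k a m2) y y' * κ y')) + ∑' y', ξ ^ 3 * (Cxi 3 ξ (y - y') * ρ y')|
      ≤ |-(∑' y', ξ ^ 3 * (dK1 ξ μ (MxiL ℓ k a m2) y y' * κ y'))| + |∑' y', ξ ^ 3 * (Cxi 3 ξ (y - y') * ρ y')| :=
        abs_add_le _ _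
    _ ≤ C * C * C * ((833 / δ ^ 3) * (833 / δ ^ 3)) + C * K * (833 / δ ^ 3) := by
        rw [abs_neg]; exact add_le_add hA hB

end CrossCM

/-! ## §5 Assembly -/

section Assembly

variable {ℓ k : ℕ} {a m2 : ℝ}

/-- kernel: the pure-`C^ξ` weighted integrand is summable. [cite: Balaban1983Higgs3, (3.27) p.441] -/
theorem summable_nonloc3_conv_conv {δ C : ℝ} (hδ : 0 < δ) (hδ1 : δ ≤ 1) (hC : 0 ≤ C)
    (l7 : ∀ u : ZSite 3, |Cxi 3 (xiOf ℓ k) u| ≤ C * prof (xiOf ℓ k) δ 1 u)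
    (l8 : ∀ (μ : Fin 3) (u : ZSite 3), |pdiffAdjZ (xiOf ℓ k)⁻¹ μ (Cxi 3 (xiOf ℓ k)) u| ≤ C * prof (xiOf ℓ k) δ 2 u)
    (μ μ' ν : Fin 3) (y : ZSite 3) :
    Summable (fun y' => nonloc3 (xiOf ℓ k) (fun x z => Cxi 3 (xiOf ℓ k) (x - z)) (fun x z => Cxi 3 (xiOf ℓ k) (x - z))
      μ μ' ν y y') := by
  set ξ : ℝ := xiOf ℓ k with hξdef
  have hξ : 0 < ξ := xiOf_pos ℓ k
  have hξ1 : ξ ≤ 1 := xiOf_le_one ℓ k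
  -- first piece: (weighted `∂^*C` leg, `P₁`) × (bounded `∂^*C`)
  have hb1 : ∀ y', |pdiffAdjZ ξ⁻¹ μ (Cxi 3 ξ) (y' - y)| ≤ C * (ξ ^ 2)⁻¹ := fun y' =>
    (l8 μ _).trans (mul_le_mul_of_nonneg_left (prof_le_inv hξ hδ.le 2 _) hC)
  have hκ : ∀ y', |pdiffAdjZ ξ⁻¹ μ' (Cxi 3 ξ) (y - y') * (ξ * ((y' ν : ℝ) - y ν))| ≤ C * prof ξ δ 1 (y' - y) := by
    intro y'
    rw [abs_mul]
    have h1 : |pdiffAdjZ ξ⁻¹ μ' (Cxi 3 ξ) (y - y')| ≤ C * prof ξ δ 2 (y' - y) := (l8 μ' _).trans_eq (by rw [prof_sub_comm])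
    have hw := abs_weight_mul_prof_le hξ δ 1 ν y y'
    calc |pdiffAdjZ ξ⁻¹ μ' (Cxi 3 ξ) (y - y')| * |ξ * ((y' ν : ℝ) - y ν)|
        ≤ (C * prof ξ δ 2 (y' - y)) * |ξ * ((y' ν : ℝ) - y ν)| := mul_le_mul_of_nonneg_right h1 (abs_nonneg _)
      _ = C * (|ξ * ((y' ν : ℝ) - y ν)| * prof ξ δ (1 + 1) (y' - y)) := by ring
      _ ≤ C * prof ξ δ 1 (y' - y) := mul_le_mul_of_nonneg_left hw hC
  have s1 : Summable fun y' => pdiffAdjZ ξ⁻¹ μ (Cxi 3 ξ) (y' - y) *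
      (pdiffAdjZ ξ⁻¹ μ' (Cxi 3 ξ) (y - y') * (ξ * ((y' ν : ℝ) - y ν))) :=
    (summable_abs_bdd_mul_prof hξ hξ1 hδ hδ1 (by norm_num : 1 ≤ 2) y hb1 hκ).of_abs
  -- second piece: (`C`, bounded) × (weighted `∂∂^*C`, `P₁` after a unit shift)
  have hb2 : ∀ y', |Cxi 3 ξ (y - y')| ≤ C * (ξ ^ 1)⁻¹ := fun y' =>
    (l7 _).trans (mul_le_mul_of_nonneg_left (prof_le_inv hξ hδ.le 1 _) hC)
  have hρ : ∀ y', |pdiffZ ξ⁻¹ μ' (pdiffAdjZ ξ⁻¹ μ (Cxi 3 ξ)) (y' - y) * (ξ * ((y' ν : ℝ) - y ν))| ≤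
      ξ⁻¹ * (C * (2 ^ 2 * Real.exp 1) + C) * prof ξ δ 1 (y' - y) := by
    intro y'
    rw [abs_mul, pdiffZ, abs_mul, abs_of_pos (inv_pos.2 hξ)]
    have hs : supNorm (unitVec μ' : ZSite 3) ≤ 1 := by rw [(supNorm_unitVec μ').1]
    have h1 : |pdiffAdjZ ξ⁻¹ μ (Cxi 3 ξ) (y' - y + unitVec μ')| ≤ C * (2 ^ 2 * Real.exp 1) * prof ξ δ 2 (y' - y) := by
      refine (l8 μ _).trans ?_
      rw [mul_assoc]
      exact mul_le_mul_of_nonneg_left (prof_shift_le hξ hξ1 hδ.le hδ1 2 (y' - y) (unitVec μ') hs) hC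
    have h2 : |pdiffAdjZ ξ⁻¹ μ (Cxi 3 ξ) (y' - y)| ≤ C * prof ξ δ 2 (y' - y) := l8 μ _
    have hw := abs_weight_mul_prof_le hξ δ 1 ν y y'
    have hp := prof_nonneg hξ.le δ 2 (y' - y)
    calc ξ⁻¹ * |pdiffAdjZ ξ⁻¹ μ (Cxi 3 ξ) (y' - y + unitVec μ') - pdiffAdjZ ξ⁻¹ μ (Cxi 3 ξ) (y' - y)| *
          |ξ * ((y' ν : ℝ) - y ν)|
        ≤ ξ⁻¹ * ((C * (2 ^ 2 * Real.exp 1) * prof ξ δ 2 (y' - y)) + C * prof ξ δ 2 (y' - y)) *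
          |ξ * ((y' ν : ℝ) - y ν)| :=
          mul_le_mul_of_nonneg_right (mul_le_mul_of_nonneg_left ((abs_sub _ _).trans (add_le_add h1 h2))
            (by positivity)) (abs_nonneg _)
      _ = ξ⁻¹ * (C * (2 ^ 2 * Real.exp 1) + C) * (|ξ * ((y' ν : ℝ) - y ν)| * prof ξ δ (1 + 1) (y' - y)) := by ring
      _ ≤ ξ⁻¹ * (C * (2 ^ 2 * Real.exp 1) + C) * prof ξ δ 1 (y' - y) :=
          mul_le_mul_of_nonneg_left hw (by positivity)
  have s2 : Summable fun y' => Cxi 3 ξ (y - y') *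
      (pdiffZ ξ⁻¹ μ' (pdiffAdjZ ξ⁻¹ μ (Cxi 3 ξ)) (y' - y) * (ξ * ((y' ν : ℝ) - y ν))) :=
    (summable_abs_bdd_mul_prof hξ hξ1 hδ hδ1 (by norm_num : 1 ≤ 2) y hb2 hρ).of_abs
  have h := (s1.neg.add s2).mul_left (ξ ^ 3)
  refine h.congr fun y' => ?_
  simp only [nonloc3, dK2_conv, d2K_conv]
  ring

/-- **THE DECOMPOSITION** `Π_{μμ′ν}[G,G] = Π_{μμ′ν}[C^ξ,C^ξ] + τΣ' nonloc3[C^ξ,M] + τΣ' nonloc3[M,G]`.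
[cite: Balaban1983Higgs3, (3.27) p.441] -/
theorem Pi3L_GxiL_decomp (τ : ℝ) (μ μ' ν : Fin 3) (y : ZSite 3)
    (sCC : Summable (fun y' => nonloc3 (xiOf ℓ k) (fun x z => Cxi 3 (xiOf ℓ k) (x - z))
      (fun x z => Cxi 3 (xiOf ℓ k) (x - z)) μ μ' ν y y'))
    (sCM : Summable (fun y' => nonloc3 (xiOf ℓ k) (fun x z => Cxi 3 (xiOf ℓ k) (x - z)) (MxiL ℓ k a m2) μ μ' ν y y'))
    (sMG : Summable (fun y' => nonloc3 (xiOf ℓ k) (MxiL ℓ k a m2) (GxiL ℓ k a m2) μ μ' ν y y')) :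
    Pi3L (xiOf ℓ k) τ (GxiL ℓ k a m2) (GxiL ℓ k a m2) μ μ' ν y =
      Pi3L (xiOf ℓ k) τ (fun x z => Cxi 3 (xiOf ℓ k) (x - z)) (fun x z => Cxi 3 (xiOf ℓ k) (x - z)) μ μ' ν y +
        τ * ∑' y', nonloc3 (xiOf ℓ k) (fun x z => Cxi 3 (xiOf ℓ k) (x - z)) (MxiL ℓ k a m2) μ μ' ν y y' +
        τ * ∑' y', nonloc3 (xiOf ℓ k) (MxiL ℓ k a m2) (GxiL ℓ k a m2) μ μ' ν y y' := by
  have hG := GxiL_eq_conv_add ℓ k a m2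
  have hsplit : ∀ y', nonloc3 (xiOf ℓ k) (GxiL ℓ k a m2) (GxiL ℓ k a m2) μ μ' ν y y' =
      nonloc3 (xiOf ℓ k) (fun x z => Cxi 3 (xiOf ℓ k) (x - z)) (fun x z => Cxi 3 (xiOf ℓ k) (x - z)) μ μ' ν y y' +
        nonloc3 (xiOf ℓ k) (fun x z => Cxi 3 (xiOf ℓ k) (x - z)) (MxiL ℓ k a m2) μ μ' ν y y' +
        nonloc3 (xiOf ℓ k) (MxiL ℓ k a m2) (GxiL ℓ k a m2) μ μ' ν y y' := by
    intro y'
    conv_lhs => rw [hG]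
    rw [nonloc3_add_left, ← hG]
    conv_lhs => arg 1; rw [hG]
    rw [nonloc3_add_right]
  unfold Pi3L
  simp_rw [hsplit]
  rw [(sCC.add sCM).tsum_add sMG, sCC.tsum_add sCM]
  ring

/-- **Π_{μμ′ν} WITH THE INFINITE-LATTICE PROPAGATOR `G^ξ_{j₀}(0)` IN BOTH SLOTS IS BOUNDED UNIFORMLY IN THE SPACING** —
p. 442 *"Thus the expression (3.27) is equal to 0 and the coefficient at the vertex [Π_{μμ′ν}] is bounded"*, assembled ON THE
PRINTED INFINITE LATTICE ξℤ³: there is `Cst` (a function of `L` and the window) with `|Π_{μμ′ν}[G^ξ_k(0),G^ξ_k(0)](y)| ≤ Cst·|tr q²|`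
for every `k ≥ 1`, `a₋ ≤ a ≤ a₊`, `0 ≤ m² ≤ m²₊`, `μ, μ′, ν`, `y ∈ ℤ³`.  Route: `G = C^ξ + M` (3.16); the pure-`C^ξ` kernel is
(3.27) `= 0` (r15 + p03); the cross terms by `tsum_nonloc3_conv_M_bound` (transposed Fubini form, AM–GM) and
`tsum_nonloc3_M_G_bound` (Fubini form at rate `δ/2`). [cite: Balaban1983Higgs3, (3.27) p.442] -/
theorem exists_Pi3L_GxiL_bound (hℓ : 1 ≤ ℓ) (amin aplus m2plus : ℝ) (ha : 0 < amin) :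
    ∃ Cst : ℝ, 0 < Cst ∧ ∀ (k : ℕ), 1 ≤ k → ∀ (a m2 : ℝ), amin ≤ a → a ≤ aplus → 0 ≤ m2 → m2 ≤ m2plus →
      ∀ (τ : ℝ) (μ μ' ν : Fin 3) (y : ZSite 3),
        |Pi3L (xiOf ℓ k) τ (GxiL ℓ k a m2) (GxiL ℓ k a m2) μ μ' ν y| ≤ Cst * |τ| := by
  obtain ⟨δ, C, K, hδ, hδh, hC1, hK, hB⟩ := exists_bounds hℓ amin aplus m2plus ha
  have hδ1 : δ ≤ 1 := hδh.trans (by norm_num)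
  have hC0 : 0 ≤ C := le_trans (by norm_num) hC1
  have hδq : 0 < δ / 2 / 2 := by positivity
  set Cst : ℝ := (C * C * C * ((833 / δ ^ 3) * (833 / δ ^ 3)) + C * K * (833 / δ ^ 3)) +
    (C * C * (C * (1 + 2 / δ)) * (1400 * (833 / (δ / 2 / 2) ^ 3)) + K * C * (833 / δ ^ 3)) + 1 with hCst
  refine ⟨Cst, by positivity, ?_⟩
  intro k hk a m2 ha1 ha2 hm1 hm2 τ μ μ' ν y
  obtain ⟨⟨l1, l2, l3, l4, l5, l6, l7, l8, l9⟩, bM, bd2, bunif, fub, fubw, fubt⟩ := hB k hk a m2 ha1 ha2 hm1 hm2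
  have hξ := xiOf_pos ℓ k
  obtain ⟨sCM, hCM⟩ := tsum_nonloc3_conv_M_bound hδ hδ1 hC0 hK.le l7 l8 bd2 fubt μ μ' ν y
  obtain ⟨sMG, hMG⟩ := tsum_nonloc3_M_G_bound hδ hδ1 hC0 hK.le l3 l4 bM fubw μ μ' ν y
  have sCC := summable_nonloc3_conv_conv hδ hδ1 hC0 l7 l8 μ μ' ν y
  rw [Pi3L_GxiL_decomp τ μ μ' ν y sCC sCM sMG, Pi3L_Cxi_eq_zero hξ τ μ μ' ν y, zero_add]
  calc |τ * ∑' y', nonloc3 (xiOf ℓ k) (fun x z => Cxi 3 (xiOf ℓ k) (x - z)) (MxiL ℓ k a m2) μ μ' ν y y' +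
        τ * ∑' y', nonloc3 (xiOf ℓ k) (MxiL ℓ k a m2) (GxiL ℓ k a m2) μ μ' ν y y'|
      ≤ |τ * ∑' y', nonloc3 (xiOf ℓ k) (fun x z => Cxi 3 (xiOf ℓ k) (x - z)) (MxiL ℓ k a m2) μ μ' ν y y'| +
        |τ * ∑' y', nonloc3 (xiOf ℓ k) (MxiL ℓ k a m2) (GxiL ℓ k a m2) μ μ' ν y y'| := abs_add_le _ _
    _ ≤ |τ| * (C * C * C * ((833 / δ ^ 3) * (833 / δ ^ 3)) + C * K * (833 / δ ^ 3)) +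
        |τ| * (C * C * (C * (1 + 2 / δ)) * (1400 * (833 / (δ / 2 / 2) ^ 3)) + K * C * (833 / δ ^ 3)) := by
        rw [abs_mul, abs_mul]
        exact add_le_add (mul_le_mul_of_nonneg_left hCM (abs_nonneg _)) (mul_le_mul_of_nonneg_left hMG (abs_nonneg _))
    _ ≤ Cst * |τ| := by
        rw [hCst]
        have hτ := abs_nonneg τ
        nlinarith [hτ]

end Assembly

end

end Literature.MathematicalPhysics.QuantumFieldTheory.Balaban1983to89.B3Pi3ZeroLattice
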